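import Mathlib
import HarnessLib

/-!
# Line `Sketch` — crux `DyadicWallCascade.ViscousContinuation` (stmt-AnomalousDissipation-17917):
# registered stub `stub_doublingTransferContracts`, PROVED

This file proves the registered stub `stub_doublingTransferContracts` of line `Sketch` of the crux
`Summit.AnomalousDissipation.AnomalousDissipation.Theses.DyadicWallCascade.ViscousContinuation`
(item stmt-AnomalousDissipation-17917, ViscousContinuation), card `lap-map-koopman-transfer`.

It is the card's one-dimensional toy: the transfer (Perron–Frobenius) operator of the doubling map,
`g ↦ (x ↦ (g (x/2) + g ((x+1)/2)) / 2)`, halves Lipschitz constants — merge-averaging contracts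
fluctuations geometrically.  Elementary: the triangle inequality and `|(x+c)/2 - (y+c)/2| = |x-y|/2`
on each of the two inverse branches; Mathlib only (`LipschitzWith.of_dist_le_mul`,
`LipschitzWith.dist_le_mul`, `Real.dist_eq`, `NNReal.coe_div`).
-/

set_option linter.dupNamespace false

namespace Summit.AnomalousDissipation.AnomalousDissipation.Theorems

/-- Each inverse branch `x ↦ (x + c)/2` of the doubling map halves distances:
`|(x + c)/2 - (y + c)/2| = |x - y| / 2`. [folklore] -/
theorem doublingTransfer_abs_branch_sub (x y c : ℝ) :
    |(x + c) / 2 - (y + c) / 2| = |x - y| / 2 := by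
  rw [show (x + c) / 2 - (y + c) / 2 = (x - y) / 2 by ring, abs_div, abs_two]

/-- Pointwise estimate behind the stub: if `g` is `K`-Lipschitz then
`|(g (x/2) + g ((x+1)/2))/2 - (g (y/2) + g ((y+1)/2))/2| ≤ (K/2) · |x - y|`. [folklore] -/
theorem doublingTransfer_dist_le (g : ℝ → ℝ) (K : NNReal) (hg : LipschitzWith K g) (x y : ℝ) :
    dist ((g (x / 2) + g ((x + 1) / 2)) / 2) ((g (y / 2) + g ((y + 1) / 2)) / 2)
      ≤ (K : ℝ) / 2 * dist x y := by
  have h1 := hg.dist_le_mul (x / 2) (y / 2)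
  have h2 := hg.dist_le_mul ((x + 1) / 2) ((y + 1) / 2)
  simp only [Real.dist_eq] at h1 h2 ⊢
  have e1 : |x / 2 - y / 2| = |x - y| / 2 := by
    simpa only [add_zero] using doublingTransfer_abs_branch_sub x y 0
  rw [e1] at h1
  rw [doublingTransfer_abs_branch_sub x y 1] at h2
  calc |(g (x / 2) + g ((x + 1) / 2)) / 2 - (g (y / 2) + g ((y + 1) / 2)) / 2|
      = |(g (x / 2) - g (y / 2)) + (g ((x + 1) / 2) - g ((y + 1) / 2))| / 2 := by
        rw [show (g (x / 2) + g ((x + 1) / 2)) / 2 - (g (y / 2) + g ((y + 1) / 2)) / 2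
            = ((g (x / 2) - g (y / 2)) + (g ((x + 1) / 2) - g ((y + 1) / 2))) / 2 by ring,
          abs_div, abs_two]
    _ ≤ (|g (x / 2) - g (y / 2)| + |g ((x + 1) / 2) - g ((y + 1) / 2)|) / 2 := by
        gcongr
        exact abs_add_le _ _
    _ ≤ ((K : ℝ) * (|x - y| / 2) + (K : ℝ) * (|x - y| / 2)) / 2 := by gcongr
    _ = (K : ℝ) / 2 * |x - y| := by ring

/-- **Registered stub (toy, S) — the doubling-map transfer operator halves Lipschitz constants**
(card lap-map-koopman-transfer, `DoublingTransferContracts`, line `Sketch` of crux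
stmt-AnomalousDissipation-17917): merge-averaging `g ↦ (g(x/2) + g((x+1)/2))/2` contracts
fluctuations geometrically — a `K`-Lipschitz `g` is sent to a `K/2`-Lipschitz function. [folklore] -/
theorem stub_doublingTransferContracts : ∀ (g : ℝ → ℝ) (K : NNReal), LipschitzWith K g → LipschitzWith (K / 2) (fun x => (g (x / 2) + g ((x + 1) / 2)) / 2) := by
  intro g K hg
  refine LipschitzWith.of_dist_le_mul fun x y => ?_
  rw [NNReal.coe_div, NNReal.coe_two]
  exact doublingTransfer_dist_le g K hg x y

end Summit.AnomalousDissipation.AnomalousDissipation.Theorems
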